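import Literature.AlgebraicGeometry.Frobenioids.ModelFrobenioidUnits
import Literature.AlgebraicGeometry.Frobenioids.ModelFrobenioidPreFrobenioid
import Literature.AlgebraicGeometry.Frobenioids.UnitsFunctor
import Literature.AlgebraicGeometry.Frobenioids.Frobenioid
import Literature.AlgebraicGeometry.Frobenioids.PadicFrobenioidDatumLemmas
import Literature.AlgebraicGeometry.Frobenioids.PadicFrobenioidIsFrobenioid
import HarnessLib

/-!
# Frobenioids I, Thm. 5.2 (i)/(ii) + Prop. 1.11 (iv): the monoid `O^▷(A)` of the model Frobenioid, explicitly
# (the "O-monoid dictionary" `O^▷(A) = {b ∈ B(A_D) | Div_B(b) ∈ Φ(A_D)}`, `O^▷(B) ↪ O^▷(A)` along a linear `φ` IS `B(Base φ)`)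

Mochizuki, *The geometry of Frobenioids I: the general theory*, Kyushu J. Math. **62** (2008), §5,
Theorem 5.2 (i) (the model Frobenioid: a morphism `φ : (A_D, α) → (B_D, β)` is the data
`(deg_Fr(φ), Base(φ), Div(φ) ∈ Φ(A_D), u_φ ∈ B(A_D))` subject to
`deg_Fr(φ)·α + Div(φ) = Φ(Base φ)(β) + Div_B(u_φ)`), kurims p. 100 [cite: MochizukiFrdI2008, Thm. 5.2(i) p.100];
Def. 1.2 (ii) (`O^▷(A)` = the base-identity linear endomorphisms of `A`); Prop. 1.11 (iv), p. 37 (a linear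
morphism `φ : A → B` induces an injection `O^▷(B) ↪ O^▷(A)`, `β ↦ α` with `φ ∘ α = β ∘ φ` — the map
`O^▷(φ)` of Prop. 2.2 (ii)(a)); and *The geometry of Frobenioids II*, §2, proof of Theorem 2.4 (i), p. 20
(the descent condition "`O^▷(C) ⥲ O^▷(B)^{Gal(B/C)}`" for the `p`-adic Frobenioid of Example 1.1 (ii))
[cite: MochizukiFrdII2008, Thm 2.4 (i) p.20].

PROOF-ONLY companion (no definitions).  For the model Frobenioid `C = ModelFrobenioid Φ B Div_B` with its
structure functor `C → F_Φ` (`toElem`), a base-identity linear endomorphism `f` of `X = (A_D, α)` is the data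
`(1, id, Div(f), u_f)` with `Div(f) = Div_B(u_f)` in `Φ(A_D)^gp` (`of_div_eq_divB_unit_of_mem_endSubmonoid`).
Hence the DICTIONARY (row W12-L01c of plan/L1/SUBDAG-FrdII-Thm24.md, abc-iut-w5-d229's census F2):

* `O^▷(X) → B(A_D)`, `f ↦ u_f`, is multiplicative (`unit_comp_of_mem_endSubmonoid`), injective as soon as
  `Φ(A_D)` is integral (`eq_of_mem_endSubmonoid_of_unit_eq`), and its image is EXACTLY the set of
  `b ∈ B(A_D)` whose `Div_B(b) ∈ Φ(A_D)^gp` is effective, i.e. lies in (the image of) `Φ(A_D)`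
  (`exists_mem_endSubmonoid_unit_eq_iff`): "`O^▷(A) = {b ∈ B(A_D) | Div_B b ∈ Φ(A_D)}`";
* along a LINEAR `φ : X ⟶ Y`, every `g ∈ O^▷(Y)` has the explicit intertwiner
  `g' = (1, id, Φ(Base φ)(Div g), B(Base φ)(u_g)) ∈ O^▷(X)` with `g' ≫ φ = φ ≫ g`
  (`exists_intertwiner_of_linear`) — Prop. 1.11 (iv)'s `O^▷(φ)(g)` — and ANY intertwiner in `O^▷(X)` has
  `u = B(Base φ)(u_g)` and `Div = Φ(Base φ)(Div g)` once `u_φ` is a unit and `Φ(A_D)` is cancellative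
  (`unit_eq_of_intertwine`, `div_eq_of_intertwine`, `eq_of_intertwine`): "the injection
  `O^▷(Y) ↪ O^▷(X)` IS `B(Base φ)`"; in particular for every `O : UnitsFunctorData (toElem Φ B Div_B)`
  ([FrdI] Prop. 2.2 (ii), abc-iut-L1-t2) `u_{O^▷(Base φ)(g)} = B(Base φ)(u_g)` (`unit_resLin_eq`);
* for the `p`-adic Frobenioid of a datum `d` ([FrdII] Ex. 1.1 (ii): `B(A)` a group, `Φ(A)` monoprime hence
  integral) all side hypotheses are discharged (`PadicFrd.Datum.*`); the one-directional `p`-adic pieces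
  `of_div_eq_divB_unit` / `eq_of_mem_of_unit_eq` / `unit_comp_of_mem` already in abc-iut-L1-t4's
  `PadicFrobenioidSplittingMonoid.lean` are NOT restated (the generic `ModelFrobenioid.*` versions here
  hold for every model Frobenioid).

Nothing here is asserted beyond what is proved; no statement of either paper is strengthened.  Seat
abc-iut-w5-d248 (L1-lead R97 (5)(b): W12-L01c `OMonoidDictionary`).
-/

noncomputable section

namespace Literature.AlgebraicGeometry.Frobenioids

namespace ModelFrobenioid

open CategoryTheory Opposite Function

universe w v u

variable {D : Type u} [Category.{v} D] {Φ B : Dᵒᵖ ⥤ CommMonCat.{w}} {DivB : B ⟶ monoidGp Φ}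
variable {X Y : ModelFrobenioid Φ B DivB}

/-! ### Base-identity linear endomorphisms of the model Frobenioid: the data `(1, id, Div f, u_f)` -/

/-- Membership in `O^▷(X)` (found's `PreFrobenioid.endSubmonoid` for the structure functor `toElem`)
unfolds to "`Base(f) = id` and `deg_Fr(f) = 1`". [cite: MochizukiFrdI2008, Def. 1.2(ii) p.22] -/
theorem mem_endSubmonoid_iff (f : X ⟶ X) :
    f ∈ PreFrobenioid.endSubmonoid (toElem Φ B DivB) X ↔ baseMap f = 𝟙 X.base ∧ degFr f = 1 :=
  Iff.rfl

/-- `Base(f) = id` for `f ∈ O^▷(X)`, in the model Frobenioid's own vocabulary. [cite: MochizukiFrdI2008, Def. 1.2(ii) p.22] -/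
theorem baseMap_eq_id_of_mem {f : X ⟶ X} (hf : f ∈ PreFrobenioid.endSubmonoid (toElem Φ B DivB) X) :
    baseMap f = 𝟙 X.base :=
  hf.1

/-- `deg_Fr(f) = 1` for `f ∈ O^▷(X)`, in the model Frobenioid's own vocabulary. [cite: MochizukiFrdI2008, Def. 1.2(ii) p.22] -/
theorem degFr_eq_one_of_mem {f : X ⟶ X} (hf : f ∈ PreFrobenioid.endSubmonoid (toElem Φ B DivB) X) :
    degFr f = 1 :=
  hf.2

/-- For `f ∈ O^▷(X)` the relation (d) of Thm. 5.2 (i) reads `Div(f) = Div_B(u_f)` in `Φ(A_D)^gp`: the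
divisor of a base-identity linear endomorphism is the (effective) divisor of its rational function.
[cite: MochizukiFrdI2008, Thm. 5.2(i) p.100] -/
theorem of_div_eq_divB_unit_of_mem_endSubmonoid {f : X ⟶ X}
    (hf : f ∈ PreFrobenioid.endSubmonoid (toElem Φ B DivB) X) :
    Algebra.GrothendieckGroup.of (div f) = divB Φ B DivB (op X.base) (unit f) := by
  have h := rel f
  rw [baseMap_eq_id_of_mem hf, degFr_eq_one_of_mem hf, PNat.one_coe, pow_one, pullGp_id] at h
  exact mul_left_cancel h

/-- `f ↦ u_f` is multiplicative on `O^▷(X)`: `u_{g ∘ f} = u_g · u_f` (recall `End X` multiplies by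
`g * f = f ≫ g`). [cite: MochizukiFrdI2008, Thm. 5.2(i) p.100] -/
theorem unit_comp_of_mem_endSubmonoid {f g : X ⟶ X}
    (hf : f ∈ PreFrobenioid.endSubmonoid (toElem Φ B DivB) X)
    (hg : g ∈ PreFrobenioid.endSubmonoid (toElem Φ B DivB) X) : unit (f ≫ g) = unit g * unit f := by
  rw [unit_comp, baseMap_eq_id_of_mem hf, degFr_eq_one_of_mem hg, map_id_apply_B, PNat.one_coe, pow_one]

/-- `f ↦ Div(f)` is multiplicative on `O^▷(X)`: `Div(g ∘ f) = Div(g) + Div(f)`.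
[cite: MochizukiFrdI2008, Thm. 5.2(i) p.100] -/
theorem div_comp_of_mem_endSubmonoid {f g : X ⟶ X}
    (hf : f ∈ PreFrobenioid.endSubmonoid (toElem Φ B DivB) X)
    (hg : g ∈ PreFrobenioid.endSubmonoid (toElem Φ B DivB) X) : div (f ≫ g) = div g * div f := by
  rw [div_comp, baseMap_eq_id_of_mem hf, degFr_eq_one_of_mem hg, map_id_apply_Φ, PNat.one_coe, pow_one]

/-- `u_{id} = 1`, `Div(id) = 0`. [cite: MochizukiFrdI2008, Thm. 5.2(i) p.100] -/
theorem unit_id_div_id (X : ModelFrobenioid Φ B DivB) : unit (𝟙 X) = 1 ∧ div (𝟙 X) = 1 := ⟨rfl, rfl⟩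

/-- **`O^▷(X) → B(A_D)` is injective** for integral `Φ(A_D)` (e.g. `Φ` divisorial): a base-identity linear
endomorphism is determined by its rational function `u_f` (since then `Div(f)`, with
`Div(f) = Div_B(u_f)` in `Φ^gp`, is determined too). [cite: MochizukiFrdI2008, Thm. 5.2(ii) p.101] -/
theorem eq_of_mem_endSubmonoid_of_unit_eq (hΦ : IsIntegral (Φ.obj (op X.base))) {f g : X ⟶ X}
    (hf : f ∈ PreFrobenioid.endSubmonoid (toElem Φ B DivB) X)
    (hg : g ∈ PreFrobenioid.endSubmonoid (toElem Φ B DivB) X) (h : unit f = unit g) : f = g := by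
  apply hom_ext
  · rw [degFr_eq_one_of_mem hf, degFr_eq_one_of_mem hg]
  · rw [baseMap_eq_id_of_mem hf, baseMap_eq_id_of_mem hg]
  · apply hΦ.injective_of
    rw [of_div_eq_divB_unit_of_mem_endSubmonoid hf, of_div_eq_divB_unit_of_mem_endSubmonoid hg, h]
  · exact h

/-- Every `b ∈ B(A_D)` whose divisor `Div_B(b)` is EFFECTIVE (`= Div d`, `d ∈ Φ(A_D)`) is the rational
function of the base-identity linear endomorphism `(1, id, d, b)` of `X` (`unitEnd`, abc-iut's
`ModelFrobenioidUnits`). [cite: MochizukiFrdI2008, Thm. 5.2(i) p.100] -/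
theorem exists_mem_endSubmonoid_unit_eq (X : ModelFrobenioid Φ B DivB) (d : Φ.obj (op X.base))
    (b : B.obj (op X.base)) (h : Algebra.GrothendieckGroup.of d = divB Φ B DivB (op X.base) b) :
    ∃ f : X ⟶ X, f ∈ PreFrobenioid.endSubmonoid (toElem Φ B DivB) X ∧ unit f = b ∧ div f = d :=
  ⟨unitEnd X d b h, ⟨rfl, rfl⟩, rfl, rfl⟩

/-- **The dictionary `O^▷(A) = {b ∈ B(A_D) | Div_B(b) ∈ Φ(A_D)}`**: an element `b ∈ B(A_D)` is the
rational function `u_f` of some base-identity linear endomorphism `f` of `X = (A_D, α)` if and only if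
`Div_B(b)` is effective. [cite: MochizukiFrdI2008, Thm. 5.2(ii) p.101] -/
theorem exists_mem_endSubmonoid_unit_eq_iff (X : ModelFrobenioid Φ B DivB) (b : B.obj (op X.base)) :
    (∃ f : X ⟶ X, f ∈ PreFrobenioid.endSubmonoid (toElem Φ B DivB) X ∧ unit f = b) ↔
      ∃ d : Φ.obj (op X.base), Algebra.GrothendieckGroup.of d = divB Φ B DivB (op X.base) b := by
  constructor
  · rintro ⟨f, hf, rfl⟩
    exact ⟨div f, of_div_eq_divB_unit_of_mem_endSubmonoid hf⟩
  · rintro ⟨d, hd⟩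
    obtain ⟨f, hf, hfb, -⟩ := exists_mem_endSubmonoid_unit_eq X d b hd
    exact ⟨f, hf, hfb⟩

/-- The same dictionary with `Div_B(b) = Div d` written the other way round (the orientation of the
descent condition (b) of [FrdII] Thm. 2.4 (i) as typed by abc-iut-w5-d229, `PadicFieldwiseSaturatedCriterion`).
[cite: MochizukiFrdI2008, Thm. 5.2(ii) p.101] -/
theorem exists_mem_endSubmonoid_unit_eq_iff' (X : ModelFrobenioid Φ B DivB) (b : B.obj (op X.base)) :
    (∃ f : X ⟶ X, f ∈ PreFrobenioid.endSubmonoid (toElem Φ B DivB) X ∧ unit f = b) ↔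
      ∃ d : Φ.obj (op X.base), divB Φ B DivB (op X.base) b = Algebra.GrothendieckGroup.of d := by
  rw [exists_mem_endSubmonoid_unit_eq_iff]
  exact exists_congr fun d => eq_comm

/-! ### Prop. 1.11 (iv) explicitly: `O^▷(Y) ↪ O^▷(X)` along a linear `φ : X ⟶ Y` is `B(Base φ)` -/

/-- Transport of the relation `Div d = Div_B(b)` along `f : A_D → A'_D` (naturality of `Div_B`), in the
form needed for `unitEnd`. [cite: MochizukiFrdI2008, Thm. 5.2(i) p.100] -/
theorem of_map_div_eq_divB_map_unit (φ : X ⟶ Y) {g : Y ⟶ Y}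
    (hg : g ∈ PreFrobenioid.endSubmonoid (toElem Φ B DivB) Y) :
    Algebra.GrothendieckGroup.of ((Φ.map (baseMap φ).op).hom (div g)) =
      divB Φ B DivB (op X.base) ((B.map (baseMap φ).op).hom (unit g)) :=
  of_map_eq_divB_map (baseMap φ) (of_div_eq_divB_unit_of_mem_endSubmonoid hg)

/-- **Prop. 1.11 (iv) for the model Frobenioid, explicitly**: for a LINEAR `φ : X ⟶ Y` and `g ∈ O^▷(Y)`
the endomorphism `g' := (1, id, Φ(Base φ)(Div g), B(Base φ)(u_g))` of `X` lies in `O^▷(X)` and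
intertwines, `g' ≫ φ = φ ≫ g` ("`φ ∘ α = β ∘ φ`") — so `O^▷(φ)(g) = g'`, with rational function
`B(Base φ)(u_g)` and divisor `Φ(Base φ)(Div g)`. [cite: MochizukiFrdI2008, Prop. 1.11(iv) p.37] -/
theorem exists_intertwiner_of_linear (φ : X ⟶ Y) (hφ : degFr φ = 1) {g : Y ⟶ Y}
    (hg : g ∈ PreFrobenioid.endSubmonoid (toElem Φ B DivB) Y) :
    ∃ g' : X ⟶ X, g' ∈ PreFrobenioid.endSubmonoid (toElem Φ B DivB) X ∧ g' ≫ φ = φ ≫ g ∧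
      unit g' = (B.map (baseMap φ).op).hom (unit g) ∧ div g' = (Φ.map (baseMap φ).op).hom (div g) := by
  refine ⟨unitEnd X _ _ (of_map_div_eq_divB_map_unit φ hg), ⟨rfl, rfl⟩, ?_, rfl, rfl⟩
  apply hom_ext
  · show degFr φ * 1 = degFr g * degFr φ
    rw [degFr_eq_one_of_mem hg, one_mul, mul_one]
  · show 𝟙 X.base ≫ baseMap φ = baseMap φ ≫ baseMap g
    rw [baseMap_eq_id_of_mem hg, Category.id_comp, Category.comp_id]
  · show (Φ.map (𝟙 X.base).op).hom (div φ) * ((Φ.map (baseMap φ).op).hom (div g)) ^ (degFr φ : ℕ) =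
      (Φ.map (baseMap φ).op).hom (div g) * div φ ^ (degFr g : ℕ)
    rw [map_id_apply_Φ, hφ, degFr_eq_one_of_mem hg, PNat.one_coe, pow_one, pow_one, mul_comm]
  · show (B.map (𝟙 X.base).op).hom (unit φ) * ((B.map (baseMap φ).op).hom (unit g)) ^ (degFr φ : ℕ) =
      (B.map (baseMap φ).op).hom (unit g) * unit φ ^ (degFr g : ℕ)
    rw [map_id_apply_B, hφ, degFr_eq_one_of_mem hg, PNat.one_coe, pow_one, pow_one, mul_comm]

/-- The case print states: along a PULL-BACK MORPHISM `φ : X ⟶ Y` of a model Frobenioid that IS a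
Frobenioid (pull-back morphisms are linear, [FrdI] Def. 1.3 (iv)(b)), every `g ∈ O^▷(Y)` has the
intertwiner `(1, id, Φ(Base φ)(Div g), B(Base φ)(u_g)) ∈ O^▷(X)` — the injection `O^▷(Y) ↪ O^▷(X)` of
Prop. 1.11 (iv) "is" `B(Base φ)` on rational functions. [cite: MochizukiFrdI2008, Prop. 1.11(iv) p.37] -/
theorem exists_intertwiner_of_isPullbackMorphism (hF : PreFrobenioid.IsFrobenioid (toElem Φ B DivB))
    (φ : X ⟶ Y) (hφ : PreFrobenioid.IsPullbackMorphism (toElem Φ B DivB) φ) {g : Y ⟶ Y}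
    (hg : g ∈ PreFrobenioid.endSubmonoid (toElem Φ B DivB) Y) :
    ∃ g' : X ⟶ X, g' ∈ PreFrobenioid.endSubmonoid (toElem Φ B DivB) X ∧ g' ≫ φ = φ ≫ g ∧
      unit g' = (B.map (baseMap φ).op).hom (unit g) ∧ div g' = (Φ.map (baseMap φ).op).hom (div g) :=
  exists_intertwiner_of_linear φ (hF.iv_b φ hφ).2 hg

/-- **Uniqueness of the rational function of an intertwiner**: if `g' ∈ O^▷(X)`, `g ∈ O^▷(Y)` and
`g' ≫ φ = φ ≫ g` for a LINEAR `φ` whose `u_φ` is a unit of `B(A_D)` (e.g. `B(A_D)` a group, as for the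
`p`-adic Frobenioid), then `u_{g'} = B(Base φ)(u_g)` — "the injection `O^▷(Y) ↪ O^▷(X)` IS `B(Base φ)`".
[cite: MochizukiFrdI2008, Prop. 1.11(iv) p.37] -/
theorem unit_eq_of_intertwine (φ : X ⟶ Y) (hφ : degFr φ = 1) (hu : IsUnit (unit φ)) {g' : X ⟶ X}
    {g : Y ⟶ Y} (hg' : g' ∈ PreFrobenioid.endSubmonoid (toElem Φ B DivB) X)
    (hg : g ∈ PreFrobenioid.endSubmonoid (toElem Φ B DivB) Y) (h : g' ≫ φ = φ ≫ g) :
    unit g' = (B.map (baseMap φ).op).hom (unit g) := by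
  have hu' := congrArg unit h
  rw [unit_comp, unit_comp, baseMap_eq_id_of_mem hg', map_id_apply_B, hφ, degFr_eq_one_of_mem hg, PNat.one_coe, pow_one, pow_one,
    mul_comm] at hu'
  exact hu.mul_right_cancel hu'

/-- … and `Div(g') = Φ(Base φ)(Div g)` when `Φ(A_D)` is cancellative (integral) and `Div(φ)` is … any
element (cancellation in `Φ(A_D)`). [cite: MochizukiFrdI2008, Prop. 1.11(iv) p.37] -/
theorem div_eq_of_intertwine (φ : X ⟶ Y) (hφ : degFr φ = 1) (hΦ : IsIntegral (Φ.obj (op X.base)))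
    {g' : X ⟶ X} {g : Y ⟶ Y} (hg' : g' ∈ PreFrobenioid.endSubmonoid (toElem Φ B DivB) X)
    (hg : g ∈ PreFrobenioid.endSubmonoid (toElem Φ B DivB) Y) (h : g' ≫ φ = φ ≫ g) :
    div g' = (Φ.map (baseMap φ).op).hom (div g) := by
  haveI : IsCancelMul (Φ.obj (op X.base)) := isIntegral_iff_isCancelMul.mp hΦ
  have hd := congrArg div h
  rw [div_comp, div_comp, baseMap_eq_id_of_mem hg', map_id_apply_Φ, hφ, degFr_eq_one_of_mem hg, PNat.one_coe, pow_one, pow_one,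
    mul_comm] at hd
  exact mul_right_cancel hd

/-- **Uniqueness of the intertwiner** (hence of Prop. 1.11 (iv)'s `O^▷(φ)(g)`) in the model Frobenioid,
for linear `φ` with `u_φ` a unit and `Φ(A_D)` integral: it is `(1, id, Φ(Base φ)(Div g), B(Base φ)(u_g))`.
[cite: MochizukiFrdI2008, Prop. 1.11(iv) p.37] -/
theorem eq_of_intertwine (φ : X ⟶ Y) (hφ : degFr φ = 1) (hu : IsUnit (unit φ))
    (hΦ : IsIntegral (Φ.obj (op X.base))) {g' g'' : X ⟶ X} {g : Y ⟶ Y}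
    (hg' : g' ∈ PreFrobenioid.endSubmonoid (toElem Φ B DivB) X)
    (hg'' : g'' ∈ PreFrobenioid.endSubmonoid (toElem Φ B DivB) X)
    (hg : g ∈ PreFrobenioid.endSubmonoid (toElem Φ B DivB) Y) (h' : g' ≫ φ = φ ≫ g)
    (h'' : g'' ≫ φ = φ ≫ g) : g' = g'' :=
  eq_of_mem_endSubmonoid_of_unit_eq hΦ hg' hg''
    ((unit_eq_of_intertwine φ hφ hu hg' hg h').trans (unit_eq_of_intertwine φ hφ hu hg'' hg h'').symm)

/-- **The abstract `O^▷(−)` of [FrdI] Prop. 2.2 (ii) agrees with `B(−)`**: for ANY units-functor datum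
`O : UnitsFunctorData (toElem Φ B Div_B)` (abc-iut-L1-t2), a linear `φ : X ⟶ Y` between isotropic objects
with `u_φ` a unit, and `g ∈ O^▷(Y)`, the rational function of `O^▷(Base φ)(g) ∈ O^▷(X)` is `B(Base φ)(u_g)`.
[cite: MochizukiFrdI2008, Prop. 2.2(ii) p.45] -/
theorem unit_resLin_eq (O : PreFrobenioid.UnitsFunctorData (toElem Φ B DivB))
    {X Y : (PreFrobenioid.isotropicObjects (toElem Φ B DivB)).FullSubcategory} (φ : X.obj ⟶ Y.obj)
    (hφ : degFr φ = 1) (hu : IsUnit (unit φ))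
    (g : PreFrobenioid.endSubmonoid (toElem Φ B DivB) Y.obj) :
    unit (show X.obj ⟶ X.obj from (O.resLin φ g).1) = (B.map (baseMap φ).op).hom (unit (show Y.obj ⟶ Y.obj from g.1)) :=
  unit_eq_of_intertwine φ hφ hu (O.resLin φ g).2 g.2 (O.res_base φ hφ g).symm

end ModelFrobenioid

/-! ### The `p`-adic Frobenioid of [FrdII] Ex. 1.1 (ii): all side hypotheses discharged -/

namespace PadicFrd

namespace Datum

open CategoryTheory Opposite Function

universe v u

variable {D : Type u} [Category.{v} D] {p : ℕ} [Fact p.Prime] (d : Datum D p)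

/-- For the `p`-adic Frobenioid, `Φ(A)` is integral (monoprime ⇒ divisorial ⇒ integral).
[cite: MochizukiFrdII2008, Ex 1.1 (ii) p.8] -/
theorem isIntegral_Φ (A : Dᵒᵖ) : IsIntegral (d.Φ.obj A) :=
  (d.isMonoprime A).isDivisorial.isPreDivisorial.isIntegral

/-- **The O-monoid dictionary for the `p`-adic Frobenioid, (1)** (the one-directional pieces —
`Div(e) = Div_B(u_e)`, injectivity of `e ↦ u_e`, multiplicativity — are abc-iut-L1-t4's
`PadicFrd.Datum.of_div_eq_divB_unit` / `eq_of_mem_of_unit_eq` / `unit_comp_of_mem` in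
`PadicFrobenioidSplittingMonoid.lean`; here the two-sided characterisation): `b ∈ B(A_D)` is the rational function
of a base-identity linear endomorphism of `X` iff `Div_B(b) ∈ Φ(A_D)^gp` is effective —
"`O^▷(A) = {b ∈ B(A_D) | Div_B b ∈ Φ(A_D)}`". [cite: MochizukiFrdII2008, Thm 2.4 (i) p.20] -/
theorem exists_mem_endSubmonoid_unit_eq_iff (X : d.frobenioid) (b : d.B.obj (op X.base)) :
    (∃ f : X ⟶ X, f ∈ PreFrobenioid.endSubmonoid d.structureFunctor X ∧ ModelFrobenioid.unit f = b) ↔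
      ∃ c : d.Φ.obj (op X.base),
        Algebra.GrothendieckGroup.of c = Frobenioids.divB d.Φ d.B d.divB (op X.base) b :=
  ModelFrobenioid.exists_mem_endSubmonoid_unit_eq_iff X b

/-- **The O-monoid dictionary for the `p`-adic Frobenioid, (2) = [FrdI] Prop. 1.11 (iv) explicitly**:
along a LINEAR `φ : X ⟶ Y`, every `g ∈ O^▷(Y)` has a UNIQUE intertwiner `g' ∈ O^▷(X)`
(`g' ≫ φ = φ ≫ g`), and its rational function is `B(Base φ)(u_g)` — "the injection
`O^▷(Y) ↪ O^▷(X)` IS `B(Base φ)`" (no hypotheses: `B(A)` is a group, `Φ(A)` is integral).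
[cite: MochizukiFrdII2008, Thm 2.4 (i) p.20] -/
theorem existsUnique_intertwiner_of_linear {X Y : d.frobenioid} (φ : X ⟶ Y)
    (hφ : ModelFrobenioid.degFr φ = 1) {g : Y ⟶ Y}
    (hg : g ∈ PreFrobenioid.endSubmonoid d.structureFunctor Y) :
    ∃! g' : X ⟶ X, g' ∈ PreFrobenioid.endSubmonoid d.structureFunctor X ∧ g' ≫ φ = φ ≫ g := by
  obtain ⟨g', hg', hcomm, -, -⟩ := ModelFrobenioid.exists_intertwiner_of_linear φ hφ hg
  exact ⟨g', ⟨hg', hcomm⟩, fun g'' hg'' =>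
    ModelFrobenioid.eq_of_intertwine φ hφ (d.isUnit_B _ _) (d.isIntegral_Φ _) hg''.1 hg' hg hg''.2 hcomm⟩

/-- The rational function of the (unique) intertwiner is `B(Base φ)(u_g)`.
[cite: MochizukiFrdII2008, Thm 2.4 (i) p.20] -/
theorem unit_eq_of_intertwine {X Y : d.frobenioid} (φ : X ⟶ Y) (hφ : ModelFrobenioid.degFr φ = 1)
    {g' : X ⟶ X} {g : Y ⟶ Y} (hg' : g' ∈ PreFrobenioid.endSubmonoid d.structureFunctor X)
    (hg : g ∈ PreFrobenioid.endSubmonoid d.structureFunctor Y) (h : g' ≫ φ = φ ≫ g) :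
    ModelFrobenioid.unit g' = (d.B.map (ModelFrobenioid.baseMap φ).op).hom (ModelFrobenioid.unit g) :=
  ModelFrobenioid.unit_eq_of_intertwine φ hφ (d.isUnit_B _ _) hg' hg h

/-- … for the abstract `O^▷(−)` of [FrdI] Prop. 2.2 (ii): `u_{O^▷(Base φ)(g)} = B(Base φ)(u_g)` for every
units-functor datum of the `p`-adic Frobenioid and every linear `φ` between isotropic objects.
[cite: MochizukiFrdII2008, Thm 2.4 (i) p.20] -/
theorem unit_resLin_eq (O : PreFrobenioid.UnitsFunctorData d.structureFunctor)
    {X Y : (PreFrobenioid.isotropicObjects d.structureFunctor).FullSubcategory} (φ : X.obj ⟶ Y.obj)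
    (hφ : ModelFrobenioid.degFr φ = 1) (g : PreFrobenioid.endSubmonoid d.structureFunctor Y.obj) :
    ModelFrobenioid.unit (show X.obj ⟶ X.obj from (O.resLin φ g).1) =
      (d.B.map (ModelFrobenioid.baseMap φ).op).hom (ModelFrobenioid.unit (show Y.obj ⟶ Y.obj from g.1)) :=
  ModelFrobenioid.unit_resLin_eq O φ hφ (d.isUnit_B _ _) g

end Datum

end PadicFrd

end Literature.AlgebraicGeometry.Frobenioids

end
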